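import Summits.BirchSwinnertonDyer.BirchSwinnertonDyer.Theorems.TameQuarticSolventSolventPairLowerBoundOfLowerHalves
import Summits.BirchSwinnertonDyer.BirchSwinnertonDyer.Theorems.TameQuarticSolventSolventPairLowerBoundOfUnitTwist
import Summits.BirchSwinnertonDyer.Rank1Residual.Additive.QuadraticTwistBSDComparisonIsogeny
import Literature.NumberTheory.EllipticCurves.Rank1Residual.Typed.CasselsLowerBound
import Literature.NumberTheory.EllipticCurves.IsogenyIdProofs
import HarnessLib

/-!
# Route `TameQuarticSolvent`, crux `SolventPairLowerBound` (stmt-BirchSwinnertonDyer-21391) —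
# the ONE item it hinges on, the rank-one LOWER half at `3` on (t′) (`TameQuarticManinParity.TprimeRankOneLowerAtThree`,
# stmt-BirchSwinnertonDyer-23739), BY NAME in Ш-WITNESS / DEEP-WITNESS CERTIFICATE currency

HONEST FRAMING. Theorems only; helper (`--supports stmt-BirchSwinnertonDyer-21391`, width seat `bsd-wall-tqs-p1-w3`
gen 4), CONDITIONAL on every displayed hypothesis; credits nothing toward closing 21391 or 23739; BSD is not
proved by any of this. No definition, no named fact, no restatement of either crux (both route decls are
concluded BY NAME). Per-class certificates and an `N`-bounded census do NOT close a leaf (cell rule).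

WHY. Five leads (tqs-p1 g0–g5, memo `Cruxes/SolventPairLowerBound/LEAD-g4-21391.md`) reduced the deciding crux to
`21391 ⟸ 23739 ∧ 19981@3 ∧ PUB²` (p588900) and declared 23739 — «the rank-one lower-half engine at an additive
potentially supersingular `3`, main-conjecture ⊇» — THE wall (no Iwasawa theory in print at `e(w∣3) = 4 > p − 1`).
This file prices that wall in the cell's own CERTIFICATE currency (the rank-ONE twin of seat ty-2 g5's
`WAll/AltClosersX1ShaWitness.lean` / `…X1DeepWitness.lean` for the X1 rank-zero leaf, and of route KT's intrinsic
cut 19618 of the (t′) rank-ZERO lower half 19981). The lower half `ord₃ #Ш_an(E) ≤ ord₃ #Ш(E)`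
(`Typed.MissingLowerBoundAt E 3`) needs NO Iwasawa theory whenever the Mazur class of `E` has a member `E′` with

  DEEP WITNESS at `(E′, k)`: `#Ш_an(E′)` is a rational `q` with `ord₃ q ≤ 2k`, and `3^{2k−1} ∣ #Ш(E′)`

— `k = 0`: `3 ∤ #Ш_an(E′)` (the inequality is TRIVIAL at `E′`, `0 ≤ ord₃ #Ш`); `k = 1`: ONE non-zero element of
`Ш(E′)[3]` (a `3`-descent / visibility certificate); Cassels–Tate squareness (`#Ш` is a perfect square, bsd.S18)
upgrades `3^{2k−1} ∣ #Ш` to `2k ≤ ord₃ #Ш`, and Cassels' isogeny invariance of the BSD quotient (Milne ADT I.7.3) with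
`L(E,s) = L(E′,s)` moves the half from `E′` to `E` in analytic rank `≤ 1` (tree:
`TwistComparison.missingLowerBoundAt_of_isIsogenous`). Inputs otherwise: FOUR PUBLISHED named facts BY NAME — `hCT`
Cassels–Tate pairing (bsd.S18), `hCassels` Cassels 1965 / Milne ADT I.7.3, `hGZK` Gross–Zagier–Kolyvagin (`Ш` finite in
analytic rank `≤ 1`), `hmod` modularity (`hasEntireLFunction_rat`). The cell is EXACT (§3): the leaf
`WAllExclAddTprimeAtThreeRankOne` hands the deep witness back on the curve itself, so `hdeep` is never stronger than
the rung, at any conductor.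

INSTRUMENT (numbers, not adjectives; local python over census `ROW2-AT3-SUBBLOCKS-v1.json` 2ae84e61… ⨝ Cremona
`ecdata/allbsd`, `N < 5·10⁵`). (t′) rank-ONE leaf: 3 533 isogeny classes — **3 526** have a member with `3 ∤ #Ш_an`
(`k = 0`); the remaining **7** classes (11 curves; `ρ̄_{E,3}` surjective on all; 2-isogenous pairs where two) have
`#Ш_an = 9` on EVERY member: `295911u1`, `248256ca1/2`, `151299b1/2`, `235944v1`, `376065h1/2`, `377397a1/2`,
`395784w1` (`k = 1`: certificate = `Ш(E)[3] ≠ 0`, one `3`-descent each — NOT run here; ASK to the census / kit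
seats); none deeper. So in CLASS currency the lower-half wall 23739 carries 7 / 3 533 classes modulo PUB⁴ and seven
descents — the content of record of the (t′) rank-one leaf is its UPPER half (route TQS 21392 / route TQMP
23736–23738: Kolyvagin + the Manin `3`-unit). (t′) rank-ZERO rows at `3` (the twist conjunct of 21391, KT 19981):
4 130 classes — 3 210 with a unit member, 913 at digit two (`#Ш_an = 9`), 7 at digit four (`#Ш_an = 81`:
`84825d1`, `126666b1`, `191601c1`, `212454bn1`, `357651bk1`, `427050ca1`, `462384fa1`; certificate = a subgroup of
order `27`).

* §0 CLASS-FREE levers (any `p`, any reduction type, analytic rank `≤ 1`):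
  `missingLowerBoundAt_of_deepWitness_of_isIsogenous`, `…_of_shaAn_unit_of_isIsogenous` (`k = 0`, no `hCT`),
  `…_of_shaTorsion_of_isIsogenous` (`k = 1`), `missingLowerBoundAt_three_of_shaAn_eq_nine_of_shaTorsion` (the door
  for the seven classes: `#Ш_an = 9` + one element of `Ш[3]`).
* §1 **23739 BY NAME**: `tprimeRankOneLowerAtThree_of_deepWitness` (PUB⁴ + `hdeep`) and the shallow
  `tprimeRankOneLowerAtThree_of_minDigit_of_witness` (PUB⁴ + MIN-DIGIT cell `hmin` + WITNESS cell `hwit`, the shapes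
  of `AltClosersX1ShaWitness` with the (t′) rank-one binders); the rank-ZERO (t′) rows likewise
  (`tprimeRankZeroLowerAtThree_of_deepWitness`).
* §2 **21391 BY NAME**: `solventPairLowerBound_of_deepWitness_of_tameLowerHalfRankZero` (+ KT 19981, via p588900),
  `solventPairLowerBound_of_deepWitness_of_unitTwistSupply` (+ w3 g2's unit-twist supply),
  `solventPairLowerBound_of_deepWitness_rankOne_rankZero` (both halves in witness currency + modularity + FH@3).
* §3 EXACTNESS: `exists_pow_dvd_shaOrder_of_missingPPartAt`, `deepWitness_of_wAllExclAddTprimeAtThreeRankOne`,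
  `deepWitness_of_tameRankOne`; §4 SUBSUMPTION `deepWitness_of_minDigit_of_witness`.

References: J. W. S. Cassels, J. reine angew. Math. 211 (1962) 95–112 and 217 (1965) 180–199; J. S. Milne,
*Arithmetic Duality Theorems* (2006) Thm. I.7.3; J. H. Silverman, *AEC* (2009) Thm. X.4.14; R. L. Miller, LMS J.
Comput. Math. 14 (2011) §1, Def. 1.1; A. W. Knapp, *Elliptic Curves* (1993) Thm. 11.67; E. F. Schaefer, M. Stoll,
Trans. AMS 356 (2004) 1209–1231 (`p`-descent); J. E. Cremona, B. Mazur, Exp. Math. 9 (2000) 13–28 (visibility);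
J. E. Cremona, *ecdata* (`allbsd`).
-/

-- D-0017: single-problem summit, so `Summit.BirchSwinnertonDyer.BirchSwinnertonDyer.…` repeats a namespace BY DESIGN.
set_option linter.dupNamespace false
set_option autoImplicit false

noncomputable section

open scoped Classical

open WeierstrassCurve Literature.NumberTheory.EllipticCurves Literature.NumberTheory.EllipticCurves.ModularForms
  Literature.NumberTheory.EllipticCurves.Rank1Residual Literature.NumberTheory.EllipticCurves.Rank1Residual.Typed
  Summit.BirchSwinnertonDyer.Rank1Residual.Additive

namespace Summit.BirchSwinnertonDyer.BirchSwinnertonDyer.Theorems.TprimeRankOneLowerWitness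

/-! ## §0 Class-free levers: the LOWER half from a deep witness on an isogenous curve (rank `≤ 1`, any `p`) -/

/-- **The typed LOWER half from a DEEP WITNESS read on an isogenous curve.** `W ∼ W'` over `ℚ` (both globally
minimal elliptic), `ord_{s=1} L(W,s) ≤ 1`; ON `W'`: `#Ш_an(W') = q'` rational with `ord_p q' ≤ 2k` and
`p^{2k−1} ∣ #Ш(W')`. Then `MissingLowerBoundAt W p`: `Ш(W')` is finite (GZK `hGZK`, equal analytic ranks — Knapp
11.67), Cassels–Tate squareness (`hCT`) gives `2k ≤ ord_p #Ш(W')`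
(`Typed.missingLowerBoundAt_of_casselsTate_of_pow_dvd`), and Cassels' isogeny invariance (`hCassels`, with
modularity `hmod`) transports the half to `W` (`TwistComparison.missingLowerBoundAt_of_isIsogenous`). `k = 0` is the
unit certificate, `k = 1` one element of `Ш(W')[p]`. CONDITIONAL on the four published facts; per curve, never a
class theorem. [cite: SilvermanAEC2009, Thm. X.4.14] [cite: MilneADT2006, Thm. I.7.3]
[cite: Miller2011LMS, §1 and Def. 1.1] [cite: Knapp1993, Thm. 11.67 (PDF p. 281)] -/
theorem missingLowerBoundAt_of_deepWitness_of_isIsogenous (hCT : exists_casselsTate_pairing (K := ℚ))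
    (hCassels : bsdRHS_eq_of_isIsogenous) (hGZK : rank_eq_analyticRank_of_analyticRank_le_one)
    (hmod : hasEntireLFunction_rat)
    (W W' : WeierstrassCurve ℚ) [W.IsElliptic] [W.IsGloballyMinimal] [W'.IsElliptic] [W'.IsGloballyMinimal]
    (hiso : IsIsogenous W W') (p : ℕ) [Fact p.Prime] (hr : W.analyticRank ≤ 1)
    {q' : ℚ} (hq' : shaAn W' = (q' : ℂ)) {k : ℕ} (hv : padicValRat p q' ≤ 2 * k)
    (hdvd : p ^ (2 * k - 1) ∣ W'.shaOrder) : MissingLowerBoundAt W p := by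
  have hr' : W'.analyticRank ≤ 1 := by rw [← analyticRank_eq_of_isIsogenous' hiso]; exact hr
  have hfin' : W'.ShaFinite := (hGZK W' hr').2
  exact TwistComparison.missingLowerBoundAt_of_isIsogenous W' W p hCassels hGZK hmod
    hiso.symm_of_isElliptic hr' (missingLowerBoundAt_of_casselsTate_of_pow_dvd W' p hCT hfin' hq' hv hdvd)

/-- **The UNIT certificate (`k = 0`), rank `≤ 1`, no Cassels–Tate needed.** If some globally minimal member
`W' ∼ W` has `#Ш_an(W') = q'` with `ord_p q' ≤ 0`, then `MissingLowerBoundAt W p` — trivially at `W'`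
(`0 ≤ ord_p #Ш(W')`), then Cassels' transport (`hCassels`, `hGZK`, `hmod`). The rank-`≤ 1` form of the tree's
rank-`0` `Theorems.missingLowerBoundAt_rankZero_of_isIsogenous_unitMember` (p439340). CONDITIONAL.
[cite: MilneADT2006, Thm. I.7.3] [cite: Miller2011LMS, §1 and Def. 1.1] -/
theorem missingLowerBoundAt_of_shaAn_unit_of_isIsogenous (hCassels : bsdRHS_eq_of_isIsogenous)
    (hGZK : rank_eq_analyticRank_of_analyticRank_le_one) (hmod : hasEntireLFunction_rat)
    (W W' : WeierstrassCurve ℚ) [W.IsElliptic] [W.IsGloballyMinimal] [W'.IsElliptic] [W'.IsGloballyMinimal]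
    (hiso : IsIsogenous W W') (p : ℕ) [Fact p.Prime] (hr : W.analyticRank ≤ 1)
    {q' : ℚ} (hq' : shaAn W' = (q' : ℂ)) (hv : padicValRat p q' ≤ 0) : MissingLowerBoundAt W p := by
  have hr' : W'.analyticRank ≤ 1 := by rw [← analyticRank_eq_of_isIsogenous' hiso]; exact hr
  have h' : MissingLowerBoundAt W' p := ⟨q', hq', hv.trans (by exact_mod_cast Nat.zero_le _)⟩
  exact TwistComparison.missingLowerBoundAt_of_isIsogenous W' W p hCassels hGZK hmod
    hiso.symm_of_isElliptic hr' h'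

/-- **The digit-two WITNESS certificate (`k = 1`), rank `≤ 1`.** `W ∼ W'`, `ord_{s=1} L(W,s) ≤ 1`; on `W'`:
`#Ш_an(W') = q'` with `ord_p q' ≤ 2` and ONE non-zero element of `Ш(W')` killed by `p` (the output of a
`p`-descent with `#Sel^{(p)} > #E(ℚ)/p`, or of a visibility argument). Then `MissingLowerBoundAt W p`
(`Typed.dvd_shaOrder_of_exists_torsion` + the deep-witness lever at `k = 1`). CONDITIONAL; per curve.
[cite: SilvermanAEC2009, Thm. X.4.14] [cite: MilneADT2006, Thm. I.7.3] [cite: Miller2011LMS, §1 and Def. 1.1] -/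
theorem missingLowerBoundAt_of_shaTorsion_of_isIsogenous (hCT : exists_casselsTate_pairing (K := ℚ))
    (hCassels : bsdRHS_eq_of_isIsogenous) (hGZK : rank_eq_analyticRank_of_analyticRank_le_one)
    (hmod : hasEntireLFunction_rat)
    (W W' : WeierstrassCurve ℚ) [W.IsElliptic] [W.IsGloballyMinimal] [W'.IsElliptic] [W'.IsGloballyMinimal]
    (hiso : IsIsogenous W W') (p : ℕ) [Fact p.Prime] (hr : W.analyticRank ≤ 1)
    {q' : ℚ} (hq' : shaAn W' = (q' : ℂ)) (hv : padicValRat p q' ≤ 2)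
    (hx : ∃ x : W'.sha, x ≠ 0 ∧ p • x = 0) : MissingLowerBoundAt W p :=
  missingLowerBoundAt_of_deepWitness_of_isIsogenous hCT hCassels hGZK hmod W W' hiso p hr hq' (k := 1)
    (by simpa using hv) (by simpa using dvd_shaOrder_of_exists_torsion W' p hx)

/-- **The door for the seven census classes** (`295911u`, `248256ca`, `151299b`, `235944v`, `376065h`, `377397a`,
`395784w`: `#Ш_an = 9` on every member, `ord_{s=1} L = 1`). For a globally minimal `E/ℚ` with
`ord_{s=1} L(E,s) ≤ 1`, `#Ш_an(E) = 9`, and ONE non-zero element of `Ш(E)` killed by `3`: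
`ord₃ #Ш_an(E) ≤ ord₃ #Ш(E)` (`MissingLowerBoundAt E 3`) — Cassels–Tate squareness (`hCT`), `Ш` finite by GZK.
The certificate is per curve (a `3`-descent, Schaefer–Stoll) and is NOT supplied here. CONDITIONAL.
[cite: SilvermanAEC2009, Thm. X.4.14] [cite: Miller2011LMS, §1 and Def. 1.1] -/
theorem missingLowerBoundAt_three_of_shaAn_eq_nine_of_shaTorsion (hCT : exists_casselsTate_pairing (K := ℚ))
    (hGZK : rank_eq_analyticRank_of_analyticRank_le_one)
    (W : WeierstrassCurve ℚ) [W.IsElliptic] (hr : W.analyticRank ≤ 1) (h9 : shaAn W = ((9 : ℚ) : ℂ))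
    (hx : ∃ x : W.sha, x ≠ 0 ∧ 3 • x = 0) : MissingLowerBoundAt W 3 :=
  haveI : Fact (Nat.Prime 3) := ⟨Nat.prime_three⟩
  -- `ord₃ 9 = 2` (the tree's `InertBadOffDescentRecords.padicValRat_three_nine`, inlined to keep the import cone small)
  have h9v : padicValRat 3 (9 : ℚ) = 2 := by
    rw [show (9 : ℚ) = ((3 ^ 2 : ℕ) : ℚ) by norm_num, padicValRat.of_nat, padicValNat.prime_pow]; norm_num
  missingLowerBoundAt_of_casselsTate_of_pow_dvd W 3 hCT (hGZK W hr).2 h9 (k := 1)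
    (by rw [h9v]; norm_num) (by simpa using dvd_shaOrder_of_exists_torsion W 3 hx)

/-! ## §1 The rank-one lower half at `3` on (t′) — item 23739 BY NAME — from PUB⁴ + the deep-witness cell -/

/-- **`TameQuarticManinParity.TprimeRankOneLowerAtThree` (stmt-BirchSwinnertonDyer-23739) ⟸ PUB⁴ + DEEP WITNESS.**
GIVEN the Cassels–Tate pairing (`hCT`, bsd.S18), Cassels' isogeny invariance of the BSD quotient (`hCassels`),
Gross–Zagier–Kolyvagin (`hGZK`), modularity (`hmod`), and — for every non-CM globally minimal (t′) curve `W` at `3`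
of analytic rank one — ONE globally minimal `W' ∼ W` carrying a deep witness at `3` (`hdeep`: `#Ш_an(W') = q`
rational, `ord₃ q ≤ 2k`, `3^{2k−1} ∣ #Ш(W')`), the lower half `Typed.MissingLowerBoundAt W 3` holds on the whole
(t′) rank-one leaf, i.e. the route decl BY NAME. Census (`N < 5·10⁵`): `k = 0` on 3 526 / 3 533 classes, `k = 1`
(`#Ш_an = 9`, one element of `Ш[3]` wanted) on 7. CONDITIONAL; credits nothing; `hdeep` is implied by the leaf (§3).
[cite: SilvermanAEC2009, Thm. X.4.14] [cite: MilneADT2006, Thm. I.7.3] [cite: Miller2011LMS, §1 and Def. 1.1] -/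
theorem tprimeRankOneLowerAtThree_of_deepWitness (hCT : exists_casselsTate_pairing (K := ℚ))
    (hCassels : bsdRHS_eq_of_isIsogenous) (hGZK : rank_eq_analyticRank_of_analyticRank_le_one)
    (hmod : hasEntireLFunction_rat)
    (hdeep : ∀ (W : WeierstrassCurve ℚ) [W.IsElliptic] [W.IsGloballyMinimal],
      ¬ W.HasCM → Addv W 3 → SubTprime W 3 → W.analyticRank = 1 →
      ∃ (W' : WeierstrassCurve ℚ) (_ : W'.IsElliptic) (_ : W'.IsGloballyMinimal), IsIsogenous W W' ∧
        ∃ q : ℚ, shaAn W' = (q : ℂ) ∧ ∃ k : ℕ, padicValRat 3 q ≤ 2 * k ∧ 3 ^ (2 * k - 1) ∣ W'.shaOrder) :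
    Summit.BirchSwinnertonDyer.BirchSwinnertonDyer.Theses.TameQuarticManinParity.TprimeRankOneLowerAtThree := by
  intro W _ _ hCM hadd hsub hr
  haveI : Fact (Nat.Prime 3) := ⟨Nat.prime_three⟩
  obtain ⟨W', iE, iM, hiso, q, hq, k, hv, hdvd⟩ := hdeep W hCM hadd hsub hr
  exact missingLowerBoundAt_of_deepWitness_of_isIsogenous hCT hCassels hGZK hmod W W' hiso 3 (by omega) hq hv
    hdvd

/-- **23739 BY NAME ⟸ PUB⁴ + the MIN-DIGIT cell + the WITNESS cell** (the shallow currency of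
`WAll/AltClosersX1ShaWitness.lean`, with the (t′) rank-one binders): `hmin` — every class on the leaf has a
globally minimal member `W'` with rational `#Ш_an(W')` of `3`-adic valuation `≤ 2` (census of record: 3 533 /
3 533, valuation `0` on 3 526 and `2` on 7); `hwit` — such a member with POSITIVE valuation carries a non-zero
element of `Ш(W')[3]`. At valuation `≤ 0` the unit lever, at `(0, 2]` the digit-two lever. CONDITIONAL; credits
nothing. [cite: SilvermanAEC2009, Thm. X.4.14] [cite: MilneADT2006, Thm. I.7.3] [cite: Miller2011LMS, §1 and Def. 1.1] -/
theorem tprimeRankOneLowerAtThree_of_minDigit_of_witness (hCT : exists_casselsTate_pairing (K := ℚ))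
    (hCassels : bsdRHS_eq_of_isIsogenous) (hGZK : rank_eq_analyticRank_of_analyticRank_le_one)
    (hmod : hasEntireLFunction_rat)
    (hmin : ∀ (W : WeierstrassCurve ℚ) [W.IsElliptic] [W.IsGloballyMinimal],
      ¬ W.HasCM → Addv W 3 → SubTprime W 3 → W.analyticRank = 1 →
      ∃ (W' : WeierstrassCurve ℚ) (_ : W'.IsElliptic) (_ : W'.IsGloballyMinimal), IsIsogenous W W' ∧
        ∃ q : ℚ, shaAn W' = (q : ℂ) ∧ padicValRat 3 q ≤ 2)
    (hwit : ∀ (W W' : WeierstrassCurve ℚ) [W.IsElliptic] [W.IsGloballyMinimal]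
      [W'.IsElliptic] [W'.IsGloballyMinimal], ¬ W.HasCM → Addv W 3 → SubTprime W 3 → W.analyticRank = 1 →
      IsIsogenous W W' → ∀ q : ℚ, shaAn W' = (q : ℂ) → 0 < padicValRat 3 q → padicValRat 3 q ≤ 2 →
      ∃ x : W'.sha, x ≠ 0 ∧ 3 • x = 0) :
    Summit.BirchSwinnertonDyer.BirchSwinnertonDyer.Theses.TameQuarticManinParity.TprimeRankOneLowerAtThree := by
  intro W _ _ hCM hadd hsub hr
  haveI : Fact (Nat.Prime 3) := ⟨Nat.prime_three⟩
  obtain ⟨W', iE, iM, hiso, q, hq, hv⟩ := hmin W hCM hadd hsub hr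
  rcases le_or_gt (padicValRat 3 q) 0 with h0 | hpos
  · exact missingLowerBoundAt_of_shaAn_unit_of_isIsogenous hCassels hGZK hmod W W' hiso 3 (by omega) hq h0
  · exact missingLowerBoundAt_of_shaTorsion_of_isIsogenous hCT hCassels hGZK hmod W W' hiso 3 (by omega) hq hv
      (hwit W W' hCM hadd hsub hr hiso q hq hpos hv)

/-- **The rank-ZERO (t′) rows at `3` in the same currency** (the body of KT's `TameLowerHalfRankZero`,
stmt-BirchSwinnertonDyer-19981, READ AT `p = 3` — not that decl by name, which quantifies over every odd `p`):
PUB⁴ + a deep witness per non-CM (t′) rank-zero class ⇒ `Typed.MissingLowerBoundAt W 3` on those rows. Census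
(`N < 5·10⁵`): 4 130 classes — `k = 0` on 3 210, `k = 1` (`#Ш_an = 9`) on 913, `k = 2` (`#Ш_an = 81`, a subgroup
of order `27` wanted) on 7. CONDITIONAL; credits nothing. [cite: SilvermanAEC2009, Thm. X.4.14]
[cite: MilneADT2006, Thm. I.7.3] [cite: Miller2011LMS, §1 and Def. 1.1] -/
theorem tprimeRankZeroLowerAtThree_of_deepWitness (hCT : exists_casselsTate_pairing (K := ℚ))
    (hCassels : bsdRHS_eq_of_isIsogenous) (hGZK : rank_eq_analyticRank_of_analyticRank_le_one)
    (hmod : hasEntireLFunction_rat)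
    (hdeep0 : ∀ (W : WeierstrassCurve ℚ) [W.IsElliptic] [W.IsGloballyMinimal],
      ¬ W.HasCM → Addv W 3 → SubTprime W 3 → W.analyticRank = 0 →
      ∃ (W' : WeierstrassCurve ℚ) (_ : W'.IsElliptic) (_ : W'.IsGloballyMinimal), IsIsogenous W W' ∧
        ∃ q : ℚ, shaAn W' = (q : ℂ) ∧ ∃ k : ℕ, padicValRat 3 q ≤ 2 * k ∧ 3 ^ (2 * k - 1) ∣ W'.shaOrder) :
    ∀ (W : WeierstrassCurve ℚ) [W.IsElliptic] [W.IsGloballyMinimal],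
      ¬ W.HasCM → Addv W 3 → SubTprime W 3 → W.analyticRank = 0 → MissingLowerBoundAt W 3 := by
  intro W _ _ hCM hadd hsub hr0
  haveI : Fact (Nat.Prime 3) := ⟨Nat.prime_three⟩
  obtain ⟨W', iE, iM, hiso, q, hq, k, hv, hdvd⟩ := hdeep0 W hCM hadd hsub hr0
  exact missingLowerBoundAt_of_deepWitness_of_isIsogenous hCT hCassels hGZK hmod W W' hiso 3 (by omega) hq hv
    hdvd

/-! ## §2 The deciding crux `SolventPairLowerBound` (stmt-BirchSwinnertonDyer-21391) BY NAME -/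

/-- **21391 ⟸ PUB⁶ + the rank-one deep-witness cell + KT's rank-zero lower half (19981).** Modularity as a newform
(`hmodN`), Friedberg–Hoffstein Thm. B(1) with ramification prescribed at `3` (`hFH`), Cassels–Tate (`hCT`), Cassels'
invariance (`hCassels`), GZK (`hGZK`), modularity of `L` (`hmod`); `hdeep` as in §1; `h0` = item
`KatoDescentTamePotSupersingular.TameLowerHalfRankZero` BY NAME. Composition of §1 with lead g4's
`solventPairLowerBound_of_tprimeRankOneLowerAtThree_of_tameLowerHalfRankZero` (p588900). CONDITIONAL; credits
nothing. [cite: FriedbergHoffstein1995, Thm. B (1)] [cite: SilvermanAEC2009, Thm. X.4.14] [cite: MilneADT2006, Thm. I.7.3] -/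
theorem solventPairLowerBound_of_deepWitness_of_tameLowerHalfRankZero (hmodN : exists_isNewformOf)
    (hFH : friedbergHoffstein_exists_pos_twist_ne_zero_ramifiedAtThree)
    (hCT : exists_casselsTate_pairing (K := ℚ)) (hCassels : bsdRHS_eq_of_isIsogenous)
    (hGZK : rank_eq_analyticRank_of_analyticRank_le_one) (hmod : hasEntireLFunction_rat)
    (hdeep : ∀ (W : WeierstrassCurve ℚ) [W.IsElliptic] [W.IsGloballyMinimal],
      ¬ W.HasCM → Addv W 3 → SubTprime W 3 → W.analyticRank = 1 →
      ∃ (W' : WeierstrassCurve ℚ) (_ : W'.IsElliptic) (_ : W'.IsGloballyMinimal), IsIsogenous W W' ∧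
        ∃ q : ℚ, shaAn W' = (q : ℂ) ∧ ∃ k : ℕ, padicValRat 3 q ≤ 2 * k ∧ 3 ^ (2 * k - 1) ∣ W'.shaOrder)
    (h0 : Summit.BirchSwinnertonDyer.BirchSwinnertonDyer.Theses.KatoDescentTamePotSupersingular.TameLowerHalfRankZero) :
    Summit.BirchSwinnertonDyer.BirchSwinnertonDyer.Theses.TameQuarticSolvent.SolventPairLowerBound :=
  SolventPairLowerBound.solventPairLowerBound_of_tprimeRankOneLowerAtThree_of_tameLowerHalfRankZero hmodN hFH
    (tprimeRankOneLowerAtThree_of_deepWitness hCT hCassels hGZK hmod hdeep) h0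

/-- **21391 ⟸ PUB⁴ + the rank-one deep-witness cell + a `3`-adic UNIT-TWIST supply** (width seat w3 g2's
`solventPairLowerBound_of_tprimeRankOneLowerAtThree_of_unitTwistSupply`, lead g4's §3.3 shape): the rank-zero
conjunct is discharged by CHOOSING the admissible twist `E_d` with `3 ∤ #Ш_an(E_d)` (`hU`, a Friedberg–Hoffstein
statement sharpened to `3`-adic units — NOT a tree fact). CONDITIONAL; credits nothing.
[cite: SilvermanAEC2009, Thm. X.4.14] [cite: MilneADT2006, Thm. I.7.3] [cite: Miller2011LMS, §1 and Def. 1.1] -/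
theorem solventPairLowerBound_of_deepWitness_of_unitTwistSupply (hCT : exists_casselsTate_pairing (K := ℚ))
    (hCassels : bsdRHS_eq_of_isIsogenous) (hGZK : rank_eq_analyticRank_of_analyticRank_le_one)
    (hmod : hasEntireLFunction_rat)
    (hdeep : ∀ (W : WeierstrassCurve ℚ) [W.IsElliptic] [W.IsGloballyMinimal],
      ¬ W.HasCM → Addv W 3 → SubTprime W 3 → W.analyticRank = 1 →
      ∃ (W' : WeierstrassCurve ℚ) (_ : W'.IsElliptic) (_ : W'.IsGloballyMinimal), IsIsogenous W W' ∧
        ∃ q : ℚ, shaAn W' = (q : ℂ) ∧ ∃ k : ℕ, padicValRat 3 q ≤ 2 * k ∧ 3 ^ (2 * k - 1) ∣ W'.shaOrder)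
    (hU : ∀ (W : WeierstrassCurve ℚ) [W.IsElliptic] [W.IsGloballyMinimal],
      ¬ W.HasCM → Addv W 3 → SubTprime W 3 → W.analyticRank = 1 →
      ∃ (d : ℤ) (Wd : WeierstrassCurve ℚ) (_ : Wd.IsElliptic) (_ : Wd.IsGloballyMinimal),
        0 < d ∧ padicValInt 3 d = 1 ∧
        (∃ C : WeierstrassCurve.VariableChange ℚ, C • W.quadraticTwist (d : ℚ) = Wd) ∧
        ¬ Wd.HasCM ∧ Addv Wd 3 ∧ SubTprime Wd 3 ∧
        Wd.analyticRank = 0 ∧ ∃ q' : ℚ, shaAn Wd = (q' : ℂ) ∧ padicValRat 3 q' ≤ 0) :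
    Summit.BirchSwinnertonDyer.BirchSwinnertonDyer.Theses.TameQuarticSolvent.SolventPairLowerBound :=
  SolventPairLowerBound.solventPairLowerBound_of_tprimeRankOneLowerAtThree_of_unitTwistSupply
    (tprimeRankOneLowerAtThree_of_deepWitness hCT hCassels hGZK hmod hdeep) hU

/-- **21391 ⟸ PUB⁶ + BOTH (t′) lower halves at `3` in deep-witness currency** (rank one for `E`, rank zero for the
Friedberg–Hoffstein twist `E_d`): composition of §1 (`hdeep`, `hdeep0`) with lead g4's
`solventPairLowerBound_of_missingLowerBoundAt` (p588900). The twist `E_d` is not steerable here, so `hdeep0` is asked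
on ALL non-CM (t′) rank-zero rows (census: `k ≤ 2` throughout, `k = 2` on 7 classes). CONDITIONAL; credits nothing.
[cite: FriedbergHoffstein1995, Thm. B (1)] [cite: SilvermanAEC2009, Thm. X.4.14] [cite: MilneADT2006, Thm. I.7.3] -/
theorem solventPairLowerBound_of_deepWitness_rankOne_rankZero (hmodN : exists_isNewformOf)
    (hFH : friedbergHoffstein_exists_pos_twist_ne_zero_ramifiedAtThree)
    (hCT : exists_casselsTate_pairing (K := ℚ)) (hCassels : bsdRHS_eq_of_isIsogenous)
    (hGZK : rank_eq_analyticRank_of_analyticRank_le_one) (hmod : hasEntireLFunction_rat)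
    (hdeep : ∀ (W : WeierstrassCurve ℚ) [W.IsElliptic] [W.IsGloballyMinimal],
      ¬ W.HasCM → Addv W 3 → SubTprime W 3 → W.analyticRank = 1 →
      ∃ (W' : WeierstrassCurve ℚ) (_ : W'.IsElliptic) (_ : W'.IsGloballyMinimal), IsIsogenous W W' ∧
        ∃ q : ℚ, shaAn W' = (q : ℂ) ∧ ∃ k : ℕ, padicValRat 3 q ≤ 2 * k ∧ 3 ^ (2 * k - 1) ∣ W'.shaOrder)
    (hdeep0 : ∀ (W : WeierstrassCurve ℚ) [W.IsElliptic] [W.IsGloballyMinimal],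
      ¬ W.HasCM → Addv W 3 → SubTprime W 3 → W.analyticRank = 0 →
      ∃ (W' : WeierstrassCurve ℚ) (_ : W'.IsElliptic) (_ : W'.IsGloballyMinimal), IsIsogenous W W' ∧
        ∃ q : ℚ, shaAn W' = (q : ℂ) ∧ ∃ k : ℕ, padicValRat 3 q ≤ 2 * k ∧ 3 ^ (2 * k - 1) ∣ W'.shaOrder) :
    Summit.BirchSwinnertonDyer.BirchSwinnertonDyer.Theses.TameQuarticSolvent.SolventPairLowerBound :=
  SolventPairLowerBound.solventPairLowerBound_of_missingLowerBoundAt hmodN hFH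
    (tprimeRankOneLowerAtThree_of_deepWitness hCT hCassels hGZK hmod hdeep)
    (tprimeRankZeroLowerAtThree_of_deepWitness hCT hCassels hGZK hmod hdeep0)

/-! ## §3 Exactness: the deep-witness cell is implied by the leaf (never stronger than the rung) -/

/-- **A full `p`-part hands back a deep witness on the curve itself.** If `Typed.MissingPPartAt W p`
(`#Ш_an(W) = q` rational with `ord_p q = ord_p #Ш(W)`), then for `k = ⌈ord_p #Ш(W) / 2⌉`: `ord_p q ≤ 2k` and
`p^{2k−1} ∣ #Ш(W)`. Elementary (`p^{ord_p n} ∣ n`). [cite: Miller2011LMS, Def. 1.1 (arXiv:1010.2431 p. 3)] -/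
theorem exists_pow_dvd_shaOrder_of_missingPPartAt (W : WeierstrassCurve ℚ) (p : ℕ) [Fact p.Prime]
    (h : MissingPPartAt W p) {q : ℚ} (hq : shaAn W = (q : ℂ)) :
    ∃ k : ℕ, padicValRat p q ≤ 2 * k ∧ p ^ (2 * k - 1) ∣ W.shaOrder := by
  obtain ⟨q₀, hq₀, hval⟩ := h
  have hqq : q₀ = q := by exact_mod_cast hq₀.symm.trans hq
  subst hqq
  set v : ℕ := padicValNat p W.shaOrder with hv
  refine ⟨(v + 1) / 2, ?_, ?_⟩
  · rw [hval]
    exact_mod_cast (by omega : v ≤ 2 * ((v + 1) / 2))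
  · exact (pow_dvd_pow p (by omega : 2 * ((v + 1) / 2) - 1 ≤ v)).trans pow_padicValNat_dvd

/-- **EXACTNESS from the leaf.** The registered W-ALL leaf `WAllExclAddTprimeAtThreeRankOne` (`BSD(E,3)` on every
non-CM (t′) rank-one curve) gives the deep-witness cell `hdeep` of §1 with `W' = W` (GZK `hGZK` for `Ш` finite;
`Typed.missingPPartAt_of_bsdp`; §3's arithmetic). So nothing in this currency is stronger than the rung, at any
conductor. [cite: Miller2011LMS, Def. 1.1 (arXiv:1010.2431 p. 3)] -/
theorem deepWitness_of_wAllExclAddTprimeAtThreeRankOne (hGZK : rank_eq_analyticRank_of_analyticRank_le_one)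
    (hleaf : Summit.BirchSwinnertonDyer.WAllExclAddTprimeAtThreeRankOne) :
    ∀ (W : WeierstrassCurve ℚ) [W.IsElliptic] [W.IsGloballyMinimal],
      ¬ W.HasCM → Addv W 3 → SubTprime W 3 → W.analyticRank = 1 →
      ∃ (W' : WeierstrassCurve ℚ) (_ : W'.IsElliptic) (_ : W'.IsGloballyMinimal), IsIsogenous W W' ∧
        ∃ q : ℚ, shaAn W' = (q : ℂ) ∧ ∃ k : ℕ, padicValRat 3 q ≤ 2 * k ∧ 3 ^ (2 * k - 1) ∣ W'.shaOrder := by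
  intro W iE iM hCM hadd hsub hr
  haveI : Fact (Nat.Prime 3) := ⟨Nat.prime_three⟩
  have hB : BSDp W 3 := hleaf W hCM hadd hsub hr
  haveI : Finite W.sha := (hGZK W (by omega)).2
  have hP : MissingPPartAt W 3 := missingPPartAt_of_bsdp W 3 hB
  obtain ⟨q, hq, -⟩ := id hP
  exact ⟨W, iE, iM, isIsogenous_self W, q, hq, exists_pow_dvd_shaOrder_of_missingPPartAt W 3 hP hq⟩

/-- **EXACTNESS from KT's residual.** Route KT's `KatoDescentTamePotSupersingular.TameRankOne`
(stmt-BirchSwinnertonDyer-19984: the full missing `p`-part on the (t′) rank-one rows at every odd tame `p`) gives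
`hdeep` at `p = 3` likewise (`W' = W`). [cite: Miller2011LMS, Def. 1.1 (arXiv:1010.2431 p. 3)] -/
theorem deepWitness_of_tameRankOne
    (h1 : Summit.BirchSwinnertonDyer.BirchSwinnertonDyer.Theses.KatoDescentTamePotSupersingular.TameRankOne) :
    ∀ (W : WeierstrassCurve ℚ) [W.IsElliptic] [W.IsGloballyMinimal],
      ¬ W.HasCM → Addv W 3 → SubTprime W 3 → W.analyticRank = 1 →
      ∃ (W' : WeierstrassCurve ℚ) (_ : W'.IsElliptic) (_ : W'.IsGloballyMinimal), IsIsogenous W W' ∧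
        ∃ q : ℚ, shaAn W' = (q : ℂ) ∧ ∃ k : ℕ, padicValRat 3 q ≤ 2 * k ∧ 3 ^ (2 * k - 1) ∣ W'.shaOrder := by
  intro W iE iM _ hadd hsub hr
  haveI : Fact (Nat.Prime 3) := ⟨Nat.prime_three⟩
  have hP : MissingPPartAt W 3 := h1 W 3 hr (by norm_num) hadd hsub
  obtain ⟨q, hq, -⟩ := id hP
  exact ⟨W, iE, iM, isIsogenous_self W, q, hq, exists_pow_dvd_shaOrder_of_missingPPartAt W 3 hP hq⟩

/-! ## §4 Subsumption: the shallow cells give the deep cell with `k ∈ {0, 1}` -/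

/-- **MIN-DIGIT + WITNESS ⇒ DEEP WITNESS** (`k = 0` at valuation `≤ 0`, `k = 1` at `(0, 2]` through
`Typed.dvd_shaOrder_of_exists_torsion`). Bookkeeping. [cite: Miller2011LMS, Def. 1.1 (arXiv:1010.2431 p. 3)] -/
theorem deepWitness_of_minDigit_of_witness
    (hmin : ∀ (W : WeierstrassCurve ℚ) [W.IsElliptic] [W.IsGloballyMinimal],
      ¬ W.HasCM → Addv W 3 → SubTprime W 3 → W.analyticRank = 1 →
      ∃ (W' : WeierstrassCurve ℚ) (_ : W'.IsElliptic) (_ : W'.IsGloballyMinimal), IsIsogenous W W' ∧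
        ∃ q : ℚ, shaAn W' = (q : ℂ) ∧ padicValRat 3 q ≤ 2)
    (hwit : ∀ (W W' : WeierstrassCurve ℚ) [W.IsElliptic] [W.IsGloballyMinimal]
      [W'.IsElliptic] [W'.IsGloballyMinimal], ¬ W.HasCM → Addv W 3 → SubTprime W 3 → W.analyticRank = 1 →
      IsIsogenous W W' → ∀ q : ℚ, shaAn W' = (q : ℂ) → 0 < padicValRat 3 q → padicValRat 3 q ≤ 2 →
      ∃ x : W'.sha, x ≠ 0 ∧ 3 • x = 0) :
    ∀ (W : WeierstrassCurve ℚ) [W.IsElliptic] [W.IsGloballyMinimal],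
      ¬ W.HasCM → Addv W 3 → SubTprime W 3 → W.analyticRank = 1 →
      ∃ (W' : WeierstrassCurve ℚ) (_ : W'.IsElliptic) (_ : W'.IsGloballyMinimal), IsIsogenous W W' ∧
        ∃ q : ℚ, shaAn W' = (q : ℂ) ∧ ∃ k : ℕ, padicValRat 3 q ≤ 2 * k ∧ 3 ^ (2 * k - 1) ∣ W'.shaOrder := by
  intro W _ _ hCM hadd hsub hr
  haveI : Fact (Nat.Prime 3) := ⟨Nat.prime_three⟩
  obtain ⟨W', iE, iM, hiso, q, hq, hv⟩ := hmin W hCM hadd hsub hr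
  rcases le_or_gt (padicValRat 3 q) 0 with h0 | hpos
  · exact ⟨W', iE, iM, hiso, q, hq, 0, by simpa using h0, by simp⟩
  · exact ⟨W', iE, iM, hiso, q, hq, 1, by simpa using hv,
      by simpa using dvd_shaOrder_of_exists_torsion W' 3 (hwit W W' hCM hadd hsub hr hiso q hq hpos hv)⟩

end Summit.BirchSwinnertonDyer.BirchSwinnertonDyer.Theorems.TprimeRankOneLowerWitness

end
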